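import Mathlib
import Summits.NavierStokesRegularity.NavierStokesRegularity.Theorems.LevelSetModerationHighSpeedPressureWorkFastSetDeficit
import Summits.NavierStokesRegularity.NavierStokesRegularity.Theorems.LevelSetModerationHighSpeedPressureWorkFastSetDuhamelGradient

/-!
# Route LevelSetModeration — `HighSpeedPressureWork`: the LOG-FREE fast-set speed-gradient bound, unit form

Support file for item stmt-NavierStokesRegularity-18149 (`HighSpeedPressureWork`), stub
`stub_earlyBookkeeping` (margin zero). Sharpening of `levelSetModeration_fastSetGradient_unit`
(`…FastSetGradientUnit.lean`, bound `A √(1 + log(B²/t))`): at a fast point the speed gradient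
is bounded by an ABSOLUTE constant in the unit normalisation,

  `‖∇‖u(t,·)‖(x)‖ ≤ A`   for `t ∈ (0,T)`, `t ≤ ε`, `‖u(t,x)‖ > 1/2`

(`levelSetModeration_fastSetGradient_logFree_unit`; `ν = 1`, speed `≤ 1` on `[0,T]`, datum
`≤ 1/2`). Assembly: the overshoot bound at the early time `s₀ = t²`
(`exists_norm_le_initial_add_of_classical_unit`: `‖u(s₀)‖ ≤ 1/2 + C₃ t`), the log-free deficit
majorant `levelSetModeration_fastSet_deficit_le` (`V₀ √(1 + log(2B_s/V₀)) ≤ (a₀ + a₁C₃)√t`),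
Hamilton's logarithmic gradient estimate `norm_fderiv_heatExtension_le_mul_sqrt_log` for the
caloric part from `s₀` (`‖∇e^{(t−s₀)Δ}g(x)‖ ≤ 2V₀√((1+log(2B_s/V₀))/(t−s₀)) ≤ 4(a₀ + a₁C₃)`), the
frozen-direction formula `fastSet_fderiv_norm_eq` and the bounded Duhamel gradient from `s₀`
(`levelSetModeration_norm_fderiv_oseenDuhamel_le_from`).
-/

noncomputable section

-- single-conjunct summit: `Summit.<Summit>.<Problem>` repeats the name by the D-0017 layout
set_option linter.dupNamespace false

namespace Summit.NavierStokesRegularity.NavierStokesRegularity.Theorems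

open MeasureTheory Set Filter Topology Function Metric
open scoped ENNReal RealInnerProductSpace
open Literature.Analysis.FluidPDE
open Literature.Analysis.UnboundedOperators (heatExtension norm_fderiv_heatExtension_le_mul_sqrt_log
  contDiff_heatExtension_holds memLp_top_of_continuous_of_bound)

/-- **Log-free fast-set speed-gradient bound, unit form.** There are absolute `A ≥ 0`, `ε > 0`
such that for every classical solution of the unforced Navier–Stokes system (`ν = 1`) on
`ℝ³ × [0, b)` with `‖u‖ ≤ 1` on `[0, T] × ℝ³` (`T < b`), `‖u(t)‖_{L²} ≤ K < ∞` there, and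
`‖u(0,·)‖ ≤ 1/2`: at every `t ∈ (0,T)` with `t ≤ ε` and every `x` with `‖u(t,x)‖ > 1/2`,
`‖∇‖u(t,·)‖(x)‖ ≤ A` — the speed gradient on the fast set at margin zero is bounded by the
natural scale, with no logarithm. [folklore] -/
theorem levelSetModeration_fastSetGradient_logFree_unit :
    ∃ A ε : ℝ, 0 ≤ A ∧ 0 < ε ∧ ∀ {b T : ℝ} {u : ℝ → EuclideanSpace ℝ (Fin 3) → EuclideanSpace ℝ (Fin 3)} {p : ℝ → EuclideanSpace ℝ (Fin 3) → ℝ}, Literature.Analysis.FluidPDE.IsClassicalNSSolutionOn (Set.Ico 0 b) 1 0 u p → 0 < T → T < b → (∀ t ∈ Set.Icc 0 T, ∀ x, ‖u t x‖ ≤ 1) → ∀ {K : ENNReal}, K ≠ ⊤ → (∀ t ∈ Set.Icc 0 T, MeasureTheory.eLpNorm (u t) 2 MeasureTheory.volume ≤ K) → (∀ x, ‖u 0 x‖ ≤ 1 / 2) → ∀ t ∈ Set.Ioo 0 T, t ≤ ε → ∀ x, 1 / 2 < ‖u t x‖ → ‖fderiv ℝ (fun y => ‖u t y‖) x‖ ≤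 A := by
  obtain ⟨C₃, hC₃, hover⟩ := exists_norm_le_initial_add_of_classical_unit
  obtain ⟨a₀, a₁, εd, ha₀, ha₁, hεd, hdef⟩ := levelSetModeration_fastSet_deficit_le
  obtain ⟨P, hP0, hPD⟩ := levelSetModeration_norm_fderiv_oseenDuhamel_le_from
  set a' : ℝ := a₀ + a₁ * C₃ with ha'_def
  have ha'0 : 0 ≤ a' := by rw [ha'_def]; positivity
  refine ⟨2 * Real.sqrt 2 * a' + P, min (1 / 2) (min εd (1 / (8 * C₃))), by positivity,
    lt_min (by norm_num) (lt_min hεd (by positivity)), ?_⟩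
  intro b T u p hcl hT hTb hbd K hK hL2 hB0 t ht htε x hfast
  have ht0 : 0 < t := ht.1
  have ht12 : t ≤ 1 / 2 := htε.trans (min_le_left _ _)
  have ht1 : t ≤ 1 := by linarith
  have htεd : t ≤ εd := htε.trans ((min_le_right _ _).trans (min_le_left _ _))
  have htC₃ : C₃ * t ≤ 1 / 8 := by
    have h1 : t ≤ 1 / (8 * C₃) := htε.trans ((min_le_right _ _).trans (min_le_right _ _))
    rw [le_div_iff₀ (by positivity)] at h1; linarith
  -- times
  have hs₀ : 0 < t ^ 2 := pow_pos ht0 2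
  have hs₀t : t ^ 2 < t := by rw [sq]; exact mul_lt_of_lt_one_left ht0 (by linarith)
  have hs₀T : t ^ 2 < T := hs₀t.trans ht.2
  have hts : t / 2 ≤ t - t ^ 2 := by
    have : t ^ 2 ≤ t * (1 / 2) := by rw [sq]; exact mul_le_mul_of_nonneg_left ht12 ht0.le
    linarith
  have hts0 : 0 < t - t ^ 2 := sub_pos.2 hs₀t
  have hsqt : 0 < Real.sqrt t := Real.sqrt_pos.2 ht0
  -- restrictions of the hypotheses
  have hcl' : IsClassicalNSSolutionOn (Ioo 0 b) 1 0 u p :=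
    hcl.mono Ioo_subset_Ico_self (uniqueDiffOn_Ioo 0 b)
  have hbd' : ∀ τ ∈ Ioc 0 T, ∀ y, ‖u τ y‖ ≤ 1 := fun τ hτ y => hbd τ ⟨hτ.1.le, hτ.2⟩ y
  have hL2' : ∀ τ ∈ Ioc 0 T, eLpNorm (u τ) 2 volume ≤ K := fun τ hτ => hL2 τ ⟨hτ.1.le, hτ.2⟩
  -- the overshoot bound at `s₀ = t²`
  set Bs : ℝ := 1 / 2 + C₃ * t with hBs
  have hBs12 : 1 / 2 ≤ Bs := by rw [hBs]; linarith [mul_nonneg hC₃.le ht0.le]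
  have hBs1 : Bs ≤ 1 := by rw [hBs]; linarith
  have hBsC : Bs - 1 / 2 ≤ C₃ * t := by rw [hBs]; linarith
  have hus₀ : ∀ y, ‖u (t ^ 2) y‖ ≤ Bs := by
    intro y
    have := hover hcl hT hTb hbd hK hL2' hB0 (t ^ 2) ⟨hs₀, hs₀T⟩ y
    rwa [sub_zero, Real.sqrt_sq ht0.le] at this
  -- the frozen direction
  have hux : 0 < ‖u t x‖ := lt_trans (by norm_num) hfast
  have hux0 : u t x ≠ 0 := norm_pos_iff.1 hux
  set e : EuclideanSpace ℝ (Fin 3) := ‖u t x‖⁻¹ • u t x with he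
  have hen : ‖e‖ = 1 := by rw [he, norm_smul, norm_inv, norm_norm, inv_mul_cancel₀ hux.ne']
  have hex : ⟪e, u t x⟫ = ‖u t x‖ := by
    rw [he, real_inner_smul_left, real_inner_self_eq_norm_sq]
    field_simp
  have hex' : 1 / 2 < ⟪e, u t x⟫ := by rw [hex]; exact hfast
  -- the deficit majorant
  obtain ⟨V₀, hδV₀, hV₀pos, hV₀M, hV₀bd⟩ := hdef hcl' hT hTb hbd' hK hL2' t ht htεd C₃ Bs hC₃.le htC₃
    hBs12 hBs1 hBsC hus₀ x e hen hex'
  -- the datum `g` and Hamilton's estimate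
  set g : EuclideanSpace ℝ (Fin 3) → ℝ := fun y => Bs - ⟪e, u (t ^ 2) y⟫ with hg
  have hcont_s₀ : Continuous (u (t ^ 2)) := (hcl'.contDiff_velocity ⟨hs₀, hs₀T.trans hTb⟩).continuous
  have hgc : Continuous g := continuous_const.sub (continuous_const.inner hcont_s₀)
  have hinner_le : ∀ y, |⟪e, u (t ^ 2) y⟫| ≤ Bs := fun y =>
    (abs_real_inner_le_norm e (u (t ^ 2) y)).trans (by rw [hen, one_mul]; exact hus₀ y)
  have hg0 : ∀ y, 0 ≤ g y := fun y => by
    have := (le_abs_self _).trans (hinner_le y)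
    simp only [hg]; linarith
  have hgM : ∀ y, g y ≤ 2 * Bs := fun y => by
    have h2 : -Bs ≤ ⟪e, u (t ^ 2) y⟫ := (neg_le_neg (hinner_le y)).trans (neg_abs_le _)
    simp only [hg]; linarith
  have hHam := norm_fderiv_heatExtension_le_mul_sqrt_log hgc hg0 hgM hts0 x hV₀pos hV₀M hδV₀
  have hgrad_f : ‖fderiv ℝ (heatExtension g (t - t ^ 2)) x‖ ≤ 2 * Real.sqrt 2 * a' := by
    refine hHam.trans ?_
    have hX0 : 0 ≤ 1 + Real.log (2 * Bs / V₀) := by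
      have : 0 ≤ Real.log (2 * Bs / V₀) := Real.log_nonneg ((one_le_div hV₀pos).2 hV₀M)
      linarith
    have h1 : Real.sqrt ((1 + Real.log (2 * Bs / V₀)) / (t - t ^ 2)) =
        Real.sqrt (1 + Real.log (2 * Bs / V₀)) / Real.sqrt (t - t ^ 2) := Real.sqrt_div hX0 _
    have h2 : Real.sqrt t / Real.sqrt 2 ≤ Real.sqrt (t - t ^ 2) := by
      rw [← Real.sqrt_div ht0.le]; exact Real.sqrt_le_sqrt hts
    have h3 : 0 < Real.sqrt (t - t ^ 2) := Real.sqrt_pos.2 hts0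
    have hsq2 : 0 < Real.sqrt 2 := Real.sqrt_pos.2 (by norm_num)
    rw [h1]
    calc 2 * V₀ * (Real.sqrt (1 + Real.log (2 * Bs / V₀)) / Real.sqrt (t - t ^ 2))
        = 2 * (V₀ * Real.sqrt (1 + Real.log (2 * Bs / V₀))) / Real.sqrt (t - t ^ 2) := by ring
      _ ≤ 2 * (a' * Real.sqrt t) / Real.sqrt (t - t ^ 2) :=
          div_le_div_of_nonneg_right (mul_le_mul_of_nonneg_left hV₀bd (by norm_num)) h3.le
      _ ≤ 2 * (a' * Real.sqrt t) / (Real.sqrt t / Real.sqrt 2) :=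
          div_le_div_of_nonneg_left (by positivity) (by positivity) h2
      _ = 2 * Real.sqrt 2 * a' := by field_simp
  -- the derivative of the speed at `x`
  obtain ⟨hDd, hDn⟩ := hPD hcl' hT hTb hbd' hK hL2' hs₀ hs₀t ht.2 ht1 x
  set Ht : EuclideanSpace ℝ (Fin 3) → EuclideanSpace ℝ (Fin 3) := heatExtension (u (t ^ 2)) (t - t ^ 2)
    with hHt
  have hgHt : heatExtension g (t - t ^ 2) = fun z => Bs - ⟪e, Ht z⟫ := by
    funext z; rw [hHt]; exact heatExtension_const_sub_inner hcont_s₀ hus₀ Bs e hts0 z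
  have hHd : Differentiable ℝ Ht := by
    rw [hHt]
    exact (contDiff_heatExtension_holds (memLp_top_of_continuous_of_bound hcont_s₀ hus₀) le_top
      hts0).differentiable (by simp)
  have hut : Differentiable ℝ (u t) :=
    (hcl'.contDiff_velocity ⟨ht.1, ht.2.trans hTb⟩).differentiable (by simp)
  have hDnorm := fastSet_fderiv_norm_eq (hut x) hux0
  have hmild : ∀ y, u t y = Ht y - oseenDuhamel 1 (t ^ 2) u u t y := fun y =>
    mild_of_bounded_of_eLpNorm_two_le_of_lt hcl' hT hTb hbd' hK hL2' hs₀ hs₀t ht.2 y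
  have hfun : u t = fun y => Ht y - oseenDuhamel 1 (t ^ 2) u u t y := funext hmild
  have hDu : fderiv ℝ (u t) x = fderiv ℝ Ht x - fderiv ℝ (fun y => oseenDuhamel 1 (t ^ 2) u u t y) x := by
    rw [hfun]; exact fderiv_fun_sub (hHd x) hDd.differentiableAt
  have hDinner : (innerSL ℝ e).comp (fderiv ℝ Ht x) = -fderiv ℝ (heatExtension g (t - t ^ 2)) x := by
    have h1 : HasFDerivAt (fun z => ⟪e, Ht z⟫) ((innerSL ℝ e).comp (fderiv ℝ Ht x)) x := by
      have := (innerSL ℝ e).hasFDerivAt.comp x (hHd x).hasFDerivAt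
      simpa [Function.comp_def] using this
    have h2 : HasFDerivAt (heatExtension g (t - t ^ 2)) (-((innerSL ℝ e).comp (fderiv ℝ Ht x))) x := by
      rw [hgHt]; exact h1.const_sub Bs
    rw [h2.fderiv, neg_neg]
  have hkey : fderiv ℝ (fun y => ‖u t y‖) x =
      -fderiv ℝ (heatExtension g (t - t ^ 2)) x -
        (innerSL ℝ e).comp (fderiv ℝ (fun y => oseenDuhamel 1 (t ^ 2) u u t y) x) := by
    rw [hDnorm, ← he, hDu, ContinuousLinearMap.comp_sub, hDinner]
  have hn1 : ‖(innerSL ℝ e).comp (fderiv ℝ (fun y => oseenDuhamel 1 (t ^ 2) u u t y) x)‖ ≤ P := by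
    refine (ContinuousLinearMap.opNorm_comp_le _ _).trans ?_
    rw [innerSL_apply_norm, hen, one_mul]
    exact hDn
  rw [hkey]
  refine (norm_sub_le _ _).trans (add_le_add ?_ hn1)
  rw [norm_neg]
  exact hgrad_f

end Summit.NavierStokesRegularity.NavierStokesRegularity.Theorems

end
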